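import Summits.CriticalPhenomena.PercolationContinuityZ3.Theorems.Transplant.Bcc111HubKit
import HarnessLib

/-!
# The bcc (111)-films `F_m(bcc)`, exit-form routing certificate VII: the THREE-DIMENSIONAL LEGS of a claw (`m ≥ 6`)

builds on p205010 (kernel theorem, internal audit signed; external expert review pending) — NOT used in this file.
Lane `prim-bschramm`, seat `prim-bschramm-p2` (gen 48; class C1b, METHOD = input substitution; memo `HOME/bschramm/P2-LATTICES.md` §159); helper file
(`--supports stmt-CriticalPhenomena-4575 --as helper`).  From a planar leg of the model («Bcc111ClawSound».`LegProps`) and a start vertex at a level in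
`[1, m−1]` over its start column, the lifts of «Bcc111Lift» give the self-avoiding film leg to the prescribed terminal, inside the rerouting set / cleared set of
«Bcc111ClearedSet», over the leg's columns:
* §1 `not_isUp_neg`, `le_of_stacked` (two vertices of one column are `≥ 3` levels apart), **`leg_plain`** (any terminal over the last column; all vertices over the
  leg's columns);
* §2 the STACKED legs entering the common column exactly at the terminal: **`leg_exact_lo`** (lower terminal; the entry test `penLo`) and **`leg_exact_hi`** (upper
  terminal; `penHi`) — all other vertices over the leg's columns but the last.
[cite: DuminilCopinSidoraviciusTassion2016, §2.3 (proof of Fact 2: the three disjoint paths γ_u, γ_v, γ_w)] [cite: ConwaySloane1999, Ch. 4 §7.1]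
-/

noncomputable section

namespace Summit.CriticalPhenomena.PercolationContinuityZ3.Theorems.Transplant

namespace Bcc111

open MeasureTheory Literature.Probability.Percolation Literature.Probability.LatticeModels SimpleGraph
open Slab111 (lev)
open BccClawX (Pt rel)
open Bcc111Claw (tnZ inRB inDB rem0 remM penLo penHi penult LegProps)
open scoped Classical

variable {m : ℕ}

/-! ## §1 Plain legs -/

/-- No vector is both an up-step and the negative of an up-step. [folklore] -/
theorem not_isUp_neg {v : Site 2} (h1 : IsUp v) (h2 : IsUp (-v)) : False := by
  have e0 := congrFun (show v = v from rfl) 0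
  rcases h1 with rfl | rfl | rfl <;> rcases h2 with h | h | h <;> have := congrFun h 0 <;> have := congrFun h 1 <;> simp_all

/-- Two distinct vertices of one column, the first below the second, are at least three levels apart. [folklore] -/
theorem le_of_stacked {Ea Eb : bfilm m} (hsh : sh Ea = sh Eb) (hlt : lev (pt Ea) < lev (pt Eb)) : lev (pt Ea) + 3 ≤ lev (pt Eb) := by
  obtain ⟨e, he⟩ := three_dvd_sub_of_adm (adm_sh_lev Ea) (hsh ▸ adm_sh_lev Eb)
  omega

/-- **A PLAIN 3D LEG** from a planar leg: from the start vertex `v` (level in `[1, m−1]`, over the start column) to any terminal `T` over the last column, inside `S`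
(given that `S` contains the interior-level vertices over the leg's columns and `T`), all vertices over the leg's columns. [cite: DuminilCopinSidoraviciusTassion2016, §2.3 (proof of Fact 2)] -/
theorem leg_plain (hm : 5 ≤ m) (z : Site 2) {R : Pt → Bool} {avoid : List Pt} {s a : Pt} {l : List Pt} (hl : LegProps R avoid s a l) {S : Set (bfilm m)}
    (hS : ∀ x : bfilm m, rel z (sh x) ∈ l → 1 ≤ lev (pt x) → lev (pt x) ≤ (m : ℤ) - 1 → x ∈ S) (v T : bfilm m) (hv : rel z (sh v) = s)
    (hv1 : 1 ≤ lev (pt v)) (hvm : lev (pt v) ≤ (m : ℤ) - 1) (hT : rel z (sh T) = a) (hTS : T ∈ S) :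
    ∃ L : List (bfilm m), GPath (film m) L v T ∧ (∀ x ∈ L, x ∈ S) ∧ (∀ x ∈ L, rel z (sh x) ∈ l) :=
  exists_lift hm z hl.ne_nil hl.chain hl.nodup v T (by rw [hv, hl.head]) hv1 hvm (by rw [hT, hl.last]) hS hTS

/-! ## §2 Stacked legs with exact entry -/

/-- The pre-entry vertex below the terminal is admissible. [folklore] -/
private theorem adm_pre_up {z : Site 2} {P a d : Pt} {T : bfilm m} (ha : a = (P.1 + d.1, P.2 + d.2)) (hu : IsUp (dvec d)) (hT : rel z (sh T) = a)
    (hT1 : 1 ≤ lev (pt T)) : Adm m (BccClawX.pt z P) (lev (pt T) - 1) := by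
  have hshT : sh T = BccClawX.pt z P + dvec d := by rw [sh_eq_pt_of_rel hT, ha, pt_add]
  have := adm_down (adm_sh_lev T) hu hT1
  rwa [hshT, add_sub_cancel_right] at this

/-- The pre-entry vertex above the terminal is admissible. [folklore] -/
private theorem adm_pre_down {z : Site 2} {P a d : Pt} {T : bfilm m} (ha : a = (P.1 + d.1, P.2 + d.2)) (hu : IsUp (-dvec d)) (hT : rel z (sh T) = a)
    (hTm : lev (pt T) + 1 ≤ m) : Adm m (BccClawX.pt z P) (lev (pt T) + 1) := by
  have hshT : sh T = BccClawX.pt z P + dvec d := by rw [sh_eq_pt_of_rel hT, ha, pt_add]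
  have := adm_up (adm_sh_lev T) hu hTm
  rwa [hshT, show BccClawX.pt z P + dvec d + -dvec d = BccClawX.pt z P by abel] at this

/-- Columns `a + u` / `a − u` (`u ∈ U`) and the entry direction. [folklore] -/
private theorem dir_of_penult {P a d : Pt} (ha : a = (P.1 + d.1, P.2 + d.2)) :
    (([(1, 0), (-1, 1), (0, -1)] : List Pt).any (fun u => P == (a.1 + u.1, a.2 + u.2)) = true → IsUp (-dvec d)) ∧
      (([(1, 0), (-1, 1), (0, -1)] : List Pt).any (fun u => P == (a.1 - u.1, a.2 - u.2)) = true → IsUp (dvec d)) := by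
  obtain ⟨p1, p2⟩ := P; obtain ⟨d1, d2⟩ := d
  subst ha
  constructor
  · intro h
    simp only [List.any_cons, List.any_nil, Bool.or_false, Bool.or_eq_true, beq_iff_eq, Prod.mk.injEq] at h
    rcases h with ⟨h1, h2⟩ | ⟨h1, h2⟩ | ⟨h1, h2⟩
    · have : d1 = -1 ∧ d2 = 0 := by omega
      refine Or.inl ?_; ext t; fin_cases t <;> simp [dvec, this]
    · have : d1 = 1 ∧ d2 = -1 := by omega
      refine Or.inr (Or.inl ?_); ext t; fin_cases t <;> simp [dvec, this]
    · have : d1 = 0 ∧ d2 = 1 := by omega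
      refine Or.inr (Or.inr ?_); ext t; fin_cases t <;> simp [dvec, this]
  · intro h
    simp only [List.any_cons, List.any_nil, Bool.or_false, Bool.or_eq_true, beq_iff_eq, Prod.mk.injEq] at h
    rcases h with ⟨h1, h2⟩ | ⟨h1, h2⟩ | ⟨h1, h2⟩
    · have : d1 = 1 ∧ d2 = 0 := by omega
      refine Or.inl ?_; ext t; fin_cases t <;> simp [dvec, this]
    · have : d1 = -1 ∧ d2 = 1 := by omega
      refine Or.inr (Or.inl ?_); ext t; fin_cases t <;> simp [dvec, this]
    · have : d1 = 0 ∧ d2 = -1 := by omega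
      refine Or.inr (Or.inr ?_); ext t; fin_cases t <;> simp [dvec, this]

/-- **THE STACKED LEG TO THE LOWER TERMINAL** `Ea` (another terminal `Eb` of the same column lies above): entering the column exactly at `Ea`, by the entry test `penLo`
of the planar leg (`τ = min (lev Ea) 2`): from `a + U` (pre-entry vertex one level up, interior) always; from `a − U` (pre-entry vertex one level down) when `τ ≥ 2`, or
`τ = 1` and the bottom vertex over the penultimate column is not removed.  All other vertices lie over the leg's columns except the last, at interior levels.
[cite: DuminilCopinSidoraviciusTassion2016, §2.3 (proof of Fact 2)] -/
theorem leg_exact_lo (hm : 6 ≤ m) (z : Site 2) {tR tD sR sD : ℕ} (htRD : tR ≤ tD) (hsRD : sR ≤ sD) {avoid : List Pt} {s a : Pt} {l : List Pt}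
    (hl : LegProps (inRB (min tR 3) (min sR 3)) avoid s a l) {τ : ℕ} (hpen : penLo (min tR 3) (min sR 3) a τ (penult l) = true)
    (v Ea Eb : bfilm m) (hv : rel z (sh v) = s) (hv1 : 1 ≤ lev (pt v)) (hvm : lev (pt v) ≤ (m : ℤ) - 1) (hEa : rel z (sh Ea) = a)
    (hsh : sh Ea = sh Eb) (hlt : lev (pt Ea) < lev (pt Eb)) (hτ : (τ : ℤ) = min (lev (pt Ea)) 2)
    (hEaW : Ea ∈ clearedSet m z tR tD sR sD ∩ (hexShadow m).lift (blkR 3 z tR sR)) :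
    ∃ L : List (bfilm m), GPath (film m) L v Ea ∧ (∀ x ∈ L, x ∈ clearedSet m z tR tD sR sD ∩ (hexShadow m).lift (blkR 3 z tR sR)) ∧
      (∀ x ∈ L, rel z (sh x) ∈ l.dropLast ∨ x = Ea) := by
  have hm5 : 5 ≤ m := le_trans (by norm_num) hm
  have hm1 : 1 ≤ m := le_trans (by norm_num) hm
  have h3 := le_of_stacked hsh hlt
  have hbm : lev (pt Eb) ≤ m := Eb.2.2
  have ha0 : 0 ≤ lev (pt Ea) := Ea.2.1
  obtain ⟨hd, hsplit, hal, hpu, hhead, hch, hnd, hadj⟩ := hl.split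
  obtain ⟨d, hdd, had⟩ := adjH_iff.1 hadj
  set P := l.dropLast.getLast hd with hP
  rw [hpu] at hpen
  have hS : ∀ x : bfilm m, rel z (sh x) ∈ l.dropLast → 1 ≤ lev (pt x) → lev (pt x) ≤ (m : ℤ) - 1 →
      x ∈ clearedSet m z tR tD sR sD ∩ (hexShadow m).lift (blkR 3 z tR sR) :=
    fun x hx h1 h2 => mem_WR_of_lev htRD hsRD (hl.mem_R _ (List.dropLast_subset l hx)) h1 h2
  have hPR : inRB (min tR 3) (min sR 3) P = true := hl.mem_R _ (List.dropLast_subset l (List.getLast_mem hd))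
  obtain ⟨hplus, hminus⟩ := dir_of_penult had (P := P)
  simp only [penLo, Bool.or_eq_true, decide_eq_true_eq, Bool.and_eq_true, beq_iff_eq, Bool.not_eq_true'] at hpen
  rcases isUp_or_of_mem_dirs hdd with hu | hu
  · -- up-step entry from `P = a − u`: pre-entry vertex `(P, lev Ea − 1)`
    have hcase : 2 ≤ τ ∨ (τ = 1 ∧ rem0 (min tR 3) (min sR 3) P = false) := by
      rcases hpen with (h | h) | ⟨⟨h1, -⟩, h3'⟩
      · exact Or.inl h
      · exact (not_isUp_neg hu (hplus h)).elim
      · exact Or.inr ⟨h1, h3'⟩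
    have hT1 : 1 ≤ lev (pt Ea) := by
      rcases hcase with h | ⟨h, -⟩
      · have : (2 : ℤ) ≤ min (lev (pt Ea)) 2 := by rw [← hτ]; exact_mod_cast h
        have := this.trans (min_le_left _ _); omega
      · have : (1 : ℤ) = min (lev (pt Ea)) 2 := by rw [← hτ]; exact_mod_cast h.symm
        have := min_le_left (lev (pt Ea)) 2; omega
    have hpreAdm : Adm m (BccClawX.pt z P) (lev (pt Ea) - 1) := adm_pre_up had hu hEa hT1
    have hpre : vtx m (BccClawX.pt z P) (lev (pt Ea) - 1) ∈ clearedSet m z tR tD sR sD ∩ (hexShadow m).lift (blkR 3 z tR sR) := by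
      have hrel : rel z (sh (vtx m (BccClawX.pt z P) (lev (pt Ea) - 1))) = P := by rw [sh_vtx hpreAdm, BccClawX.rel_pt]
      rcases hcase with h | ⟨h, hrem⟩
      · have : (2 : ℤ) ≤ min (lev (pt Ea)) 2 := by rw [← hτ]; exact_mod_cast h
        have := this.trans (min_le_left _ _)
        exact mem_WR_of_lev htRD hsRD (by rw [hrel]; exact hPR) (by rw [lev_vtx hpreAdm]; omega) (by rw [lev_vtx hpreAdm]; omega)
      · have e1 : lev (pt Ea) = 1 := by
          have : (1 : ℤ) = min (lev (pt Ea)) 2 := by rw [← hτ]; exact_mod_cast h.symm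
          rcases le_total (lev (pt Ea)) 2 with h' | h'
          · rw [min_eq_left h'] at this; omega
          · rw [min_eq_right h'] at this; omega
        exact mem_WR_of_bottom htRD hsRD hm1 (by rw [hrel]; exact hPR) (by rw [lev_vtx hpreAdm, e1]; ring) (by rw [hrel]; exact hrem)
    exact exists_lift_exact_up hm5 z hd hch hnd had hu hal v Ea (by rw [hv, hhead]) hv1 hvm hEa hT1 hS hpre hEaW
  · -- down-step entry from `P = a + u`: pre-entry vertex `(P, lev Ea + 1)`, interior
    have hTm : lev (pt Ea) + 1 ≤ m := by omega
    have hpreAdm : Adm m (BccClawX.pt z P) (lev (pt Ea) + 1) := adm_pre_down had hu hEa hTm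
    have hpre : vtx m (BccClawX.pt z P) (lev (pt Ea) + 1) ∈ clearedSet m z tR tD sR sD ∩ (hexShadow m).lift (blkR 3 z tR sR) :=
      mem_WR_of_lev htRD hsRD (by rw [sh_vtx hpreAdm, BccClawX.rel_pt]; exact hPR) (by rw [lev_vtx hpreAdm]; omega) (by rw [lev_vtx hpreAdm]; omega)
    exact exists_lift_exact_down hm5 z hd hch hnd had hu hal v Ea (by rw [hv, hhead]) hv1 hvm hEa hTm hS hpre hEaW

/-- **THE STACKED LEG TO THE UPPER TERMINAL** `Eb` (another terminal `Ea` of the same column lies below): entering exactly at `Eb`, by the entry test `penHi`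
(`τ = min (m − lev Eb) 2`): from `a − U` always; from `a + U` when `τ ≥ 2`, or `τ = 1` and the top vertex over the penultimate column is not removed.
[cite: DuminilCopinSidoraviciusTassion2016, §2.3 (proof of Fact 2)] -/
theorem leg_exact_hi (hm : 6 ≤ m) (z : Site 2) {tR tD sR sD : ℕ} (htRD : tR ≤ tD) (hsRD : sR ≤ sD) {avoid : List Pt} {s a : Pt} {l : List Pt}
    (hl : LegProps (inRB (min tR 3) (min sR 3)) avoid s a l) {τ : ℕ} (hpen : penHi (min tR 3) (min sR 3) a τ (penult l) = true)
    (v Ea Eb : bfilm m) (hv : rel z (sh v) = s) (hv1 : 1 ≤ lev (pt v)) (hvm : lev (pt v) ≤ (m : ℤ) - 1) (hEb : rel z (sh Eb) = a)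
    (hsh : sh Ea = sh Eb) (hlt : lev (pt Ea) < lev (pt Eb)) (hτ : (τ : ℤ) = min ((m : ℤ) - lev (pt Eb)) 2)
    (hEbW : Eb ∈ clearedSet m z tR tD sR sD ∩ (hexShadow m).lift (blkR 3 z tR sR)) :
    ∃ L : List (bfilm m), GPath (film m) L v Eb ∧ (∀ x ∈ L, x ∈ clearedSet m z tR tD sR sD ∩ (hexShadow m).lift (blkR 3 z tR sR)) ∧
      (∀ x ∈ L, rel z (sh x) ∈ l.dropLast ∨ x = Eb) := by
  have hm5 : 5 ≤ m := le_trans (by norm_num) hm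
  have hm1 : 1 ≤ m := le_trans (by norm_num) hm
  have h3 := le_of_stacked hsh hlt
  have hbm : lev (pt Eb) ≤ m := Eb.2.2
  have ha0 : 0 ≤ lev (pt Ea) := Ea.2.1
  obtain ⟨hd, hsplit, hal, hpu, hhead, hch, hnd, hadj⟩ := hl.split
  obtain ⟨d, hdd, had⟩ := adjH_iff.1 hadj
  set P := l.dropLast.getLast hd with hP
  rw [hpu] at hpen
  have hS : ∀ x : bfilm m, rel z (sh x) ∈ l.dropLast → 1 ≤ lev (pt x) → lev (pt x) ≤ (m : ℤ) - 1 →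
      x ∈ clearedSet m z tR tD sR sD ∩ (hexShadow m).lift (blkR 3 z tR sR) :=
    fun x hx h1 h2 => mem_WR_of_lev htRD hsRD (hl.mem_R _ (List.dropLast_subset l hx)) h1 h2
  have hPR : inRB (min tR 3) (min sR 3) P = true := hl.mem_R _ (List.dropLast_subset l (List.getLast_mem hd))
  obtain ⟨hplus, hminus⟩ := dir_of_penult had (P := P)
  simp only [penHi, Bool.or_eq_true, decide_eq_true_eq, Bool.and_eq_true, beq_iff_eq, Bool.not_eq_true'] at hpen
  rcases isUp_or_of_mem_dirs hdd with hu | hu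
  · -- up-step entry from `P = a − u`: pre-entry vertex `(P, lev Eb − 1)`, interior
    have hT1 : 1 ≤ lev (pt Eb) := by omega
    have hpreAdm : Adm m (BccClawX.pt z P) (lev (pt Eb) - 1) := adm_pre_up had hu hEb hT1
    have hpre : vtx m (BccClawX.pt z P) (lev (pt Eb) - 1) ∈ clearedSet m z tR tD sR sD ∩ (hexShadow m).lift (blkR 3 z tR sR) :=
      mem_WR_of_lev htRD hsRD (by rw [sh_vtx hpreAdm, BccClawX.rel_pt]; exact hPR) (by rw [lev_vtx hpreAdm]; omega) (by rw [lev_vtx hpreAdm]; omega)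
    exact exists_lift_exact_up hm5 z hd hch hnd had hu hal v Eb (by rw [hv, hhead]) hv1 hvm hEb hT1 hS hpre hEbW
  · -- down-step entry from `P = a + u`: pre-entry vertex `(P, lev Eb + 1)`
    have hcase : 2 ≤ τ ∨ (τ = 1 ∧ remM (min tR 3) (min sR 3) P = false) := by
      rcases hpen with (h | h) | ⟨⟨h1, -⟩, h3'⟩
      · exact Or.inl h
      · exact (not_isUp_neg (hminus h) hu).elim
      · exact Or.inr ⟨h1, h3'⟩
    have hTm : lev (pt Eb) + 1 ≤ m := by
      rcases hcase with h | ⟨h, -⟩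
      · have : (2 : ℤ) ≤ min ((m : ℤ) - lev (pt Eb)) 2 := by rw [← hτ]; exact_mod_cast h
        have := this.trans (min_le_left _ _); omega
      · have : (1 : ℤ) = min ((m : ℤ) - lev (pt Eb)) 2 := by rw [← hτ]; exact_mod_cast h.symm
        have := min_le_left ((m : ℤ) - lev (pt Eb)) 2; omega
    have hpreAdm : Adm m (BccClawX.pt z P) (lev (pt Eb) + 1) := adm_pre_down had hu hEb hTm
    have hpre : vtx m (BccClawX.pt z P) (lev (pt Eb) + 1) ∈ clearedSet m z tR tD sR sD ∩ (hexShadow m).lift (blkR 3 z tR sR) := by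
      have hrel : rel z (sh (vtx m (BccClawX.pt z P) (lev (pt Eb) + 1))) = P := by rw [sh_vtx hpreAdm, BccClawX.rel_pt]
      rcases hcase with h | ⟨h, hrem⟩
      · have : (2 : ℤ) ≤ min ((m : ℤ) - lev (pt Eb)) 2 := by rw [← hτ]; exact_mod_cast h
        have := this.trans (min_le_left _ _)
        exact mem_WR_of_lev htRD hsRD (by rw [hrel]; exact hPR) (by rw [lev_vtx hpreAdm]; omega) (by rw [lev_vtx hpreAdm]; omega)
      · have e1 : lev (pt Eb) = (m : ℤ) - 1 := by
          have : (1 : ℤ) = min ((m : ℤ) - lev (pt Eb)) 2 := by rw [← hτ]; exact_mod_cast h.symm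
          rcases le_total ((m : ℤ) - lev (pt Eb)) 2 with h' | h'
          · rw [min_eq_left h'] at this; omega
          · rw [min_eq_right h'] at this; omega
        exact mem_WR_of_top htRD hsRD hm1 (by rw [hrel]; exact hPR) (by rw [lev_vtx hpreAdm, e1]; ring) (by rw [hrel]; exact hrem)
    exact exists_lift_exact_down hm5 z hd hch hnd had hu hal v Eb (by rw [hv, hhead]) hv1 hvm hEb hTm hS hpre hEbW

end Bcc111

end Summit.CriticalPhenomena.PercolationContinuityZ3.Theorems.Transplant

end
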